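import Literature.NumberTheory.Transcendental.PkappaTheta
import Literature.NumberTheory.EllipticCurves.WeierstrassAdditionProofs
import HarnessLib

/-!
# The theta map of `M_κ` separates points

Topic: `Literature/NumberTheory/Transcendental`. A brick towards the discharge of the named fact
`philippon1986_std` (`PhilipponZeroEstimateStd.lean`), complementing `PkappaTheta.lean`: there
the theta functions `Θ_J` of the group varieties `M_κ = 𝔾ₘ^β × P_κ` (`GaGmE.Std.theta`) were
shown to be entire, automorphic under `ker(exp_{M_κ})` with a common non-vanishing factor
(`exists_theta_add_ker`) and without common zeros (`exists_theta_ne_zero`), so that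
`w ↦ [Θ(w)] ∈ ℙ^N` is a well-defined map on `M_κ(ℂ) = Lie M_κ,ℂ / ker`. Here we PROVE that this
map is **injective**:

* `sub_mem_ker_of_theta_eq_mul` — if `Θ_J(w') = c·Θ_J(w)` for all `J` with one `c ≠ 0`, then
  `w' - w ∈ GaGmE.Std.ker L κM`; `exists_theta_eq_mul_iff` — the iff form.

This is the set-theoretic half of "the linear system `|∑_b 3F_{0,b} + D_∞|` (Segre'd with
`𝔾ₘ^β ⊂ ℙ^β`) is very ample on `M_κ`", needed whenever points of the embedded group
`G ⊂ ℙ^N` of Philippon's/Roy's zero estimate (Nesterenko–Philippon (eds.), LNM 1752, Ch. 11) are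
to be identified with points of `M_κ(ℂ)` — translates, stabilisers, the count `card((Σ + H)/H)`
of Thm. 4.1 are statements about `Lie M_κ,ℂ` modulo `ker` in the named fact.

## Proof

Blockwise in the chart `M₀` of `w` (`M₀ b = 2` over the lattice, `0` elsewhere, so all blocks
`P_{M₀ b}(z_b) ≠ 0`, and then also at `w'`): the torus coordinates give `e^{y'_j} = e^{y_j}`,
i.e. `y'_j - y_j ∈ 2πiℤ`; comparing `Θ_{(none,(M₀[b ↦ i], none))}`, `i = 0, 1, 2`, the block vectors
`(P₀, P₁, P₂)(z'_b)` and `(P₀, P₁, P₂)(z_b)` are proportional, and `[P₀ : P₁ : P₂] = [1 : ℘ : ℘′]`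
is injective on `ℂ/Λ` (`sub_mem_lattice_of_univExtP_eq_mul`: off `Λ`, `℘(z') = ℘(z)` forces
`z' ≡ ±z` by the tree's `PeriodPair.weierstrassP_eq_weierstrassP_iff`, and `℘′(z') = ℘′(z)`
excludes `z' ≡ -z` unless `℘′(z) = 0`, i.e. `2z ∈ Λ`,
`PeriodPair.two_mul_mem_lattice_of_derivWeierstrassP_eq_zero`; over `Λ` exactly `P₀ = σ³ = 0`),
so `z'_b = z_b + λ_b`, `λ_b ∈ Λ`; finally the affine fibre coordinates
`Θ_{(M₀,e)}/Θ_{(M₀,none)} = s_e - ∑_b κ_{eb} (Z_{M₀ b}/P_{M₀ b})(z_b)` agree at `w` and `w'`, and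
`(Zᵢ/Pᵢ)(z + λ) = (Zᵢ/Pᵢ)(z) + η(λ)` (`univExtZ_div_univExtP_add_lattice`, from
`PeriodPair.exists_univExtTheta_add_lattice`), whence `s'_e - s_e = ∑_b κ_{eb} η(λ_b)` — the
`s`-component of the kernel vector with `z`-component `(λ_b)`.

## References

* A. Baker, G. Wüstholz, *Logarithmic Forms and Diophantine Geometry*, CUP 2007, §6.7, §6.9
  (projective embeddings of commutative group varieties, after Faltings–Wüstholz, Knop–Lange).
* E. T. Whittaker, G. N. Watson, *A Course of Modern Analysis*, §20.32 (zeros of `℘′`), §20.53.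
* Yu. V. Nesterenko, P. Philippon (eds.), *Introduction to Algebraic Independence Theory*,
  LNM 1752, Springer 2001, Ch. 11 (D. Roy), §2.1, Thm. 4.1.
-/

noncomputable section

open Complex
open scoped PeriodPair

namespace Literature.NumberTheory.Transcendental

namespace GaGmE

namespace Std

variable {β γ δ : Type} [Fintype β] [Fintype γ] [Fintype δ] [DecidableEq γ]
variable (L : PeriodPair) (κM : δ → γ → Kbar)

/-! ### One factor: `[P₀ : P₁ : P₂]` separates the points of `E` -/

/-- **`z ↦ [P₀(z) : P₁(z) : P₂(z)] = [1 : ℘(z) : ℘′(z)]` is injective on `ℂ/Λ`**: if the block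
vectors at `z'` and `z` are proportional (non-zero factor) then `z' - z ∈ Λ` (off the lattice:
`℘(z') = ℘(z)` gives `z' ≡ ±z`, and `℘′(z') = ℘′(z)` excludes `z' ≡ -z` unless `2z ∈ Λ`; over the
lattice `P₀ = σ³` vanishes exactly there). [folklore] -/
theorem sub_mem_lattice_of_univExtP_eq_mul {z z' d : ℂ} (hd : d ≠ 0)
    (h : ∀ i, L.univExtP i z' = d * L.univExtP i z) : z' - z ∈ L.lattice := by
  have hσ : ∀ u : ℂ, L.univExtP 0 u = 0 → u ∈ L.lattice := fun u hu => by
    by_contra hu'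
    rw [PeriodPair.univExtP_zero, PeriodPair.sigmaDeriv_zero_eq] at hu
    exact pow_ne_zero 3 (L.weierstrassSigma_ne_zero hu') hu
  by_cases hz : z ∈ L.lattice
  · -- over the lattice `P₀ = 0` at `z`, hence at `z'`
    obtain ⟨m, n, hmn⟩ := PeriodPair.mem_lattice.mp hz
    obtain ⟨c, -, h0, -⟩ := L.exists_univExtTheta_lattice m n 0
    simp only [PeriodPair.univExtTheta_inl, hmn] at h0
    have h0' : L.univExtP 0 z' = 0 := by rw [h 0, h0, mul_zero]
    exact sub_mem (hσ z' h0') hz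
  · have hz' : z' ∉ L.lattice := by
      intro hz'
      obtain ⟨m, n, hmn⟩ := PeriodPair.mem_lattice.mp hz'
      obtain ⟨c, -, h0, -⟩ := L.exists_univExtTheta_lattice m n 0
      simp only [PeriodPair.univExtTheta_inl, hmn] at h0
      have : L.univExtP 0 z = 0 := by
        have := h 0
        rw [h0] at this
        exact (mul_eq_zero.mp this.symm).resolve_left hd
      exact hz (hσ z this)
    obtain ⟨p0, p1, p2⟩ := PeriodPair.univExtP_eq hz
    obtain ⟨q0, q1, q2⟩ := PeriodPair.univExtP_eq hz'
    have hs : L.weierstrassSigma z ^ 3 ≠ 0 := pow_ne_zero _ (L.weierstrassSigma_ne_zero hz)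
    have hs' : L.weierstrassSigma z' ^ 3 ≠ 0 := pow_ne_zero _ (L.weierstrassSigma_ne_zero hz')
    have e0 : L.weierstrassSigma z' ^ 3 = d * L.weierstrassSigma z ^ 3 := by rw [← p0, ← q0, h 0]
    have h℘ : ℘[L] z' = ℘[L] z := by
      have := h 1
      rw [q1, p1, e0] at this
      -- `d σ³ ℘(z') = d σ³ ℘(z)`
      have hne : d * L.weierstrassSigma z ^ 3 ≠ 0 := mul_ne_zero hd hs
      exact mul_left_cancel₀ hne (by rw [this]; ring)
    have h℘' : ℘'[L] z' = ℘'[L] z := by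
      have := h 2
      rw [q2, p2, e0] at this
      have hne : d * L.weierstrassSigma z ^ 3 ≠ 0 := mul_ne_zero hd hs
      exact mul_left_cancel₀ hne (by rw [this]; ring)
    rcases (L.weierstrassP_eq_weierstrassP_iff hz' hz).mp h℘ with hplus | hminus
    · -- `z' ≡ -z`: then `℘′(z) = 0`, so `2z ∈ Λ`
      have hodd : ℘'[L] z' = -℘'[L] z := by
        have e : z' = -z + (z' + z) := by ring
        rw [e, ← L.derivWeierstrassP_neg z]
        exact L.derivWeierstrassP_add_coe (-z) ⟨z' + z, hplus⟩
      have h0 : ℘'[L] z = 0 := by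
        have e1 : ℘'[L] z = -℘'[L] z := h℘'.symm.trans hodd
        linear_combination e1 / 2
      have h2 := L.two_mul_mem_lattice_of_derivWeierstrassP_eq_zero hz h0
      have e : z' - z = (z' + z) - 2 * z := by ring
      rw [e]
      exact sub_mem hplus h2
    · exact hminus

/-! ### The `ζ`-companions shift by quasi-periods -/

/-- `Zᵢ/Pᵢ (z + λ) = Zᵢ/Pᵢ (z) + η(λ)` for `λ = mω₁ + nω₂` wherever `Pᵢ(z) ≠ 0` (the companions
are `σ³ζ·(…)`-corrected blocks and `ζ(z + λ) = ζ(z) + η(λ)`). [folklore] -/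
theorem univExtZ_div_univExtP_add_lattice (i : Fin 3) (m n : ℤ) {z : ℂ} (hP : L.univExtP i z ≠ 0) :
    L.univExtZ i (z + (m * L.ω₁ + n * L.ω₂)) / L.univExtP i (z + (m * L.ω₁ + n * L.ω₂)) =
      L.univExtZ i z / L.univExtP i z + (m * L.η₁ + n * L.η₂) := by
  obtain ⟨c, hc, h⟩ := L.exists_univExtTheta_add_lattice m n z 0
  have hPz := h (Sum.inl i)
  have hZz := h (Sum.inr i)
  simp only [PeriodPair.univExtTheta_inl, PeriodPair.univExtTheta_inr, zero_add, zero_mul,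
    zero_sub, mul_neg] at hPz hZz
  -- `P(z+λ) = c P(z)`, `η(λ) P(z+λ) - Z(z+λ) = -c Z(z)`
  have hP' : L.univExtP i (z + (m * L.ω₁ + n * L.ω₂)) ≠ 0 := by rw [hPz]; exact mul_ne_zero hc hP
  rw [hPz] at hZz
  rw [div_add' _ _ _ hP, div_eq_div_iff hP' hP, hPz]
  linear_combination (-(L.univExtP i z)) * hZz

/-! ### Affine coordinates in a chart `M` -/

omit [Fintype β] [Fintype δ] in
/-- **Block ratios**: `Θ_{(none,(M[b ↦ i], none))}/Θ_{(none,(M,none))} = Pᵢ(z'_b)/P_{M b}(z'_b)`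
wherever `Θ_{(none,(M,none))} ≠ 0`. [folklore] -/
theorem thetaPnone_update_div (M : γ → Fin 3) (b : γ) (i : Fin 3) (v : β ⊕ (γ ⊕ δ) → ℂ)
    (hv : thetaPnone (β := β) (δ := δ) L M v ≠ 0) :
    thetaPnone (β := β) (δ := δ) L (Function.update M b i) v / thetaPnone (β := β) (δ := δ) L M v =
      L.univExtP i (v (iz b)) / L.univExtP (M b) (v (iz b)) := by
  classical
  have hvb : ∀ r, L.univExtP (M r) (v (iz r)) ≠ 0 := fun r =>
    (Finset.prod_ne_zero_iff.mp hv) r (Finset.mem_univ r)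
  have hupd : ∀ r, L.univExtP (Function.update M b i r) (v (iz r)) =
      Function.update (fun r => L.univExtP (M r) (v (iz r))) b (L.univExtP i (v (iz b))) r := by
    intro r
    by_cases hrb : r = b
    · subst hrb; simp
    · simp [Function.update_of_ne hrb]
  unfold thetaPnone
  rw [Finset.prod_congr rfl fun r _ => hupd r, Finset.prod_update_of_mem (Finset.mem_univ b),
    Finset.prod_eq_mul_prod_sdiff_singleton_of_mem (Finset.mem_univ b)
      (fun r => L.univExtP (M r) (v (iz r))),
    mul_div_mul_right _ _ (Finset.prod_ne_zero_iff.mpr fun r _ => hvb r)]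

omit [Fintype β] [Fintype δ] in
/-- **Fibre ratios**: `Θ_{(none,(M, e))}/Θ_{(none,(M,none))} = s_e - ∑_b κ_{eb} (Z_{M b}/P_{M b})(z'_b)`
wherever `Θ_{(none,(M,none))} ≠ 0` — the affine fibre coordinate `ν_e` corrected to the chart
`M`. [folklore] -/
theorem thetaPsome_div_thetaPnone (M : γ → Fin 3) (e : δ) (v : β ⊕ (γ ⊕ δ) → ℂ)
    (hv : thetaPnone (β := β) (δ := δ) L M v ≠ 0) :
    thetaPsome (β := β) L κM M e v / thetaPnone (β := β) (δ := δ) L M v =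
      v (is e) - ∑ b, (κM e b : ℂ) * (L.univExtZ (M b) (v (iz b)) / L.univExtP (M b) (v (iz b))) := by
  have hvb : ∀ b, L.univExtP (M b) (v (iz b)) ≠ 0 := fun b =>
    (Finset.prod_ne_zero_iff.mp hv) b (Finset.mem_univ b)
  unfold thetaPsome
  rw [sub_div, mul_div_assoc, div_self hv, mul_one, Finset.sum_div]
  congr 1
  refine Finset.sum_congr rfl fun b _ => ?_
  rw [thetaPnone, ← Finset.mul_prod_erase Finset.univ _ (Finset.mem_univ b), mul_div_assoc,
    mul_div_mul_right _ _ (Finset.prod_ne_zero_iff.mpr fun b' _ => hvb b')]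

/-! ### The theorem -/

omit [Fintype β] [Fintype δ] in
/-- **The theta map of `M_κ` separates points**: if `Θ(w') = c · Θ(w)` for a constant `c ≠ 0`
(i.e. `[Θ(w')] = [Θ(w)]` in `ℙ^N`, all `Θ_J` being proportional), then `w' - w ∈ ker(exp_{M_κ})`.
Together with `GaGmE.Std.exists_theta_add_ker` (the converse) and `GaGmE.Std.exists_theta_ne_zero`:
`w ↦ [Θ(w)]` is a well-defined INJECTIVE map `M_κ(ℂ) = Lie M_κ,ℂ / ker → ℙ^N`. Blockwise: the
torus coordinates give `e^{y'_j} = e^{y_j}`; in every `E`-factor `[P₀ : P₁ : P₂]` is injective on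
`ℂ/Λ` (`sub_mem_lattice_of_univExtP_eq_mul`), so `z'_b = z_b + λ_b`; and the fibre coordinates
`Θ_{(M,e)}/Θ_{(M,none)} = s_e - ∑_b κ_{eb} Z_{M b}/P_{M b}(z_b)` then force
`s'_e - s_e = ∑_b κ_{eb} η(λ_b)`, which is exactly the `s`-component of the kernel vector with
`z`-component `(λ_b)`. [folklore] -/
theorem sub_mem_ker_of_theta_eq_mul (w w' : β ⊕ (γ ⊕ δ) → ℂ) {c : ℂ} (hc : c ≠ 0)
    (h : ∀ J, theta L κM J w' = c * theta L κM J w) : w' - w ∈ ker L κM := by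
  classical
  -- the chart at `w`
  let M₀ : γ → Fin 3 := fun b => if w (iz b) ∈ L.lattice then 2 else 0
  have hM₀ : ∀ b, L.univExtP (M₀ b) (w (iz b)) ≠ 0 := by
    intro b
    by_cases hb : w (iz b) ∈ L.lattice
    · obtain ⟨m', n', hmn⟩ := PeriodPair.mem_lattice.mp hb
      obtain ⟨c', hc', -, -, h2, -⟩ := L.exists_univExtTheta_lattice m' n' 0
      simp only [PeriodPair.univExtTheta_inl] at h2
      have : M₀ b = 2 := if_pos hb
      rw [this, ← hmn, h2]
      exact mul_ne_zero hc' (by norm_num)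
    · have : M₀ b = 0 := if_neg hb
      rw [this, (PeriodPair.univExtP_eq hb).1]
      exact pow_ne_zero _ (L.weierstrassSigma_ne_zero hb)
  have hPi : thetaPnone (β := β) (δ := δ) L M₀ w ≠ 0 := Finset.prod_ne_zero_iff.mpr fun b _ => hM₀ b
  have hPi' : thetaPnone (β := β) (δ := δ) L M₀ w' = c * thetaPnone (β := β) (δ := δ) L M₀ w := by
    simpa [theta] using h (none, (M₀, none))
  have hPi'ne : thetaPnone (β := β) (δ := δ) L M₀ w' ≠ 0 := by rw [hPi']; exact mul_ne_zero hc hPi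
  have hM₀' : ∀ b, L.univExtP (M₀ b) (w' (iz b)) ≠ 0 := fun b =>
    (Finset.prod_ne_zero_iff.mp hPi'ne) b (Finset.mem_univ b)
  -- torus coordinates
  have hy : ∀ j, ∃ p : ℤ, (w' - w) (iy j) = p * (2 * Real.pi * I) := by
    intro j
    have hj := h (some j, (M₀, none))
    simp only [theta, thetaT_some, thetaP_none] at hj
    rw [hPi'] at hj
    have hexp : cexp (w' (iy j)) = cexp (w (iy j)) :=
      mul_right_cancel₀ (mul_ne_zero hc hPi) (by linear_combination hj)
    obtain ⟨p, hp⟩ := Complex.exp_eq_exp_iff_exists_int.mp hexp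
    exact ⟨p, by rw [Pi.sub_apply, hp]; ring⟩
  -- `E`-coordinates
  have hz : ∀ b, w' (iz b) - w (iz b) ∈ L.lattice := by
    intro b
    -- the block ratios agree: `Pᵢ/P_{M₀ b}(z'_b) = Pᵢ/P_{M₀ b}(z_b)`
    have key : ∀ i, L.univExtP i (w' (iz b)) / L.univExtP (M₀ b) (w' (iz b)) =
        L.univExtP i (w (iz b)) / L.univExtP (M₀ b) (w (iz b)) := by
      intro i
      have hi := h (none, (Function.update M₀ b i, none))
      simp only [theta, thetaT_none, thetaP_none, one_mul] at hi
      rw [← thetaPnone_update_div L M₀ b i w' hPi'ne, ← thetaPnone_update_div L M₀ b i w hPi, hi, hPi',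
        mul_div_mul_left _ _ hc]
    refine sub_mem_lattice_of_univExtP_eq_mul L
      (d := L.univExtP (M₀ b) (w' (iz b)) / L.univExtP (M₀ b) (w (iz b)))
      (div_ne_zero (hM₀' b) (hM₀ b)) fun i => ?_
    have := key i
    rw [div_eq_div_iff (hM₀' b) (hM₀ b)] at this
    rw [div_mul_eq_mul_div, eq_div_iff (hM₀ b)]
    linear_combination this
  choose m n hmn using fun b => PeriodPair.mem_lattice.mp (hz b)
  have hzb : ∀ b, w' (iz b) = w (iz b) + (m b * L.ω₁ + n b * L.ω₂) := fun b => by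
    have := hmn b
    linear_combination -this
  -- fibre coordinates
  have hs : ∀ e, (w' - w) (is e) = ∑ b, (κM e b : ℂ) * (m b * L.η₁ + n b * L.η₂) := by
    intro e
    have he := h (none, (M₀, some e))
    simp only [theta, thetaT_none, thetaP_some, one_mul, thetaPsome] at he
    -- divide by `Π(w') = c Π(w)` : the affine fibre coordinates agree
    have h1 := thetaPsome_div_thetaPnone L κM M₀ e w' hPi'ne
    have h2 := thetaPsome_div_thetaPnone L κM M₀ e w hPi
    unfold thetaPsome at h1 h2
    rw [he, hPi', mul_div_mul_left _ _ hc, h2] at h1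
    -- `h1 : n_e(w) = n_e(w')`; shift the companions
    have hshift : ∀ b, L.univExtZ (M₀ b) (w' (iz b)) / L.univExtP (M₀ b) (w' (iz b)) =
        L.univExtZ (M₀ b) (w (iz b)) / L.univExtP (M₀ b) (w (iz b)) + (m b * L.η₁ + n b * L.η₂) := by
      intro b
      rw [hzb b]
      exact univExtZ_div_univExtP_add_lattice L (M₀ b) (m b) (n b) (hM₀ b)
    have hsum' : ∑ b, (κM e b : ℂ) * (L.univExtZ (M₀ b) (w' (iz b)) / L.univExtP (M₀ b) (w' (iz b))) =
        ∑ b, (κM e b : ℂ) * (L.univExtZ (M₀ b) (w (iz b)) / L.univExtP (M₀ b) (w (iz b))) +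
          ∑ b, (κM e b : ℂ) * (m b * L.η₁ + n b * L.η₂) := by
      rw [← Finset.sum_add_distrib]
      exact Finset.sum_congr rfl fun b _ => by rw [hshift b, mul_add]
    rw [hsum'] at h1
    rw [Pi.sub_apply]
    linear_combination -h1
  exact ⟨hy, m, n, fun b => by rw [Pi.sub_apply, hzb b]; ring, hs⟩

omit [Fintype β] [Fintype δ] in
/-- **Injectivity of `[Θ]` on `M_κ(ℂ)`** (iff form): `[Θ(w')] = [Θ(w)]` in `ℙ^N` iff
`w' - w ∈ ker(exp_{M_κ})`. [folklore] -/
theorem exists_theta_eq_mul_iff (w w' : β ⊕ (γ ⊕ δ) → ℂ) :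
    (∃ c : ℂ, c ≠ 0 ∧ ∀ J, theta L κM J w' = c * theta L κM J w) ↔ w' - w ∈ ker L κM := by
  constructor
  · rintro ⟨c, hc, h⟩
    exact sub_mem_ker_of_theta_eq_mul L κM w w' hc h
  · intro h
    obtain ⟨c, hc, hk⟩ := exists_theta_add_ker L κM w h
    refine ⟨c, hc, fun J => ?_⟩
    rw [← hk J, add_sub_cancel]

end Std

end GaGmE

end Literature.NumberTheory.Transcendental

end
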